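import Summits.FinalStateConjecture.FinalStateConjecture.Theorems.PhotonSphereChannelsExteriorEnergy

/-!
# Route PhotonSphereChannels — the channel energies of `UniformPhotonSphereChannels` in the item's literal vocabulary

Packaging of the energy–flux calculus (`PhotonSphereChannelsEnergyIdentity`, `…EnergyInequalities`,
`…ExteriorEnergy`) in the LITERAL `let`-vocabulary of the route decls `UniformPhotonSphereChannels`
(item stmt-FinalStateConjecture-10045) and `FixedModeChannels` (stmt-FinalStateConjecture-10048) of
`Summits/FinalStateConjecture/FinalStateConjecture/Theses/PhotonSphereChannels.lean`: the binders
`V`, `e`, `IsSol`, `Eext` below are copied verbatim from those decls, so that inside a proof or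
refutation of either item, after `intro … V e IsSol Ω P Eext hsol`, the conclusions of
`channelEnergies_of_isSol` are available by `exact` (the `let`s unfold definitionally).

For every `M > 0`, radius function `r > 2M` with `r' = 1 − 2M/r`, `s ≤ ℓ`, `ρ ≥ 0` and every `C²`
solution `ψ` (`∀ z, IsSol ψ z`):
1. `Eext t₂ ≤ Eext t₁` whenever `|t₁| ≤ |t₂|` and `t₁ t₂ ≥ 0` (energy only leaves the receding
   two-ended exterior region);
2. the two channel energies are limits: `liminf_{+∞} Eext = ⨅_{t ≥ 0} Eext t`,
   `liminf_{−∞} Eext = ⨅_{t ≤ 0} Eext t`;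
3. finite times suffice: `liminf_{+∞} Eext + liminf_{−∞} Eext ≤ Eext T₊ + Eext T₋` for all
   `T₋ ≤ 0 ≤ T₊`, in particular `≤ 2 · Eext 0`.
So the right-hand side of K1 / `FixedModeChannels` is controlled from above by exterior energies
at any finite pair of times (the reduction used by every refutation note on the item), and from
below it is an honest infimum (the form a proof of `FixedModeChannels` starts from).  The items'
hypotheses `r x_c = 3M` and `s ≤ 2` are not needed for these facts.  No new definitions. [folklore]
-/

namespace Summit.FinalStateConjecture.FinalStateConjecture.Theorems

open MeasureTheory Set Filter Topology

noncomputable section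

namespace WaveEnergy

/-- **Channel energies of a Regge–Wheeler solution, in the literal vocabulary of
`UniformPhotonSphereChannels` / `FixedModeChannels`.** With `V`, `e`, `IsSol`, `Eext` the items'
own `let`s: for every `C²` solution, (1) `|t|`-monotonicity of `Eext` on each time-sign,
(2) the `liminf`s at `±∞` are the infima over `t ≥ 0` / `t ≤ 0`, (3) `liminf⁺ + liminf⁻ ≤
Eext T₊ + Eext T₋` for all finite `T₋ ≤ 0 ≤ T₊`, and (4) `≤ 2 · Eext 0`. [folklore] -/
theorem channelEnergies_of_isSol (M : ℝ) (hM : 0 < M) (r : ℝ → ℝ) (xc : ℝ)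
    (hr : ∀ x, 2 * M < r x) (hr' : ∀ x, HasDerivAt r (1 - 2 * M / r x) x) (s ℓ : ℕ)
    (hsℓ : s ≤ ℓ) (ρ : ℝ) (hρ : 0 ≤ ρ) (ψ : ℝ → ℝ → ℝ) (hψ : ContDiff ℝ 2 (Function.uncurry ψ)) :
    let V : ℝ → ℝ := fun x => (1 - 2 * M / r x) * ((ℓ : ℝ) * ((ℓ : ℝ) + 1) / r x ^ 2
      + (1 - (s : ℝ) ^ 2) * (2 * M) / r x ^ 3)
    let e : (ℝ → ℝ → ℝ) → ℝ → ℝ → ℝ := fun φ t x =>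
      deriv (fun τ => φ τ x) t ^ 2 + deriv (φ t) x ^ 2 + V x * φ t x ^ 2
    let IsSol : (ℝ → ℝ → ℝ) → ℝ × ℝ → Prop := fun φ z =>
      iteratedDeriv 2 (fun τ => φ τ z.2) z.1 - iteratedDeriv 2 (φ z.1) z.2 + V z.2 * φ z.1 z.2 = 0
    let Eext : ℝ → ENNReal := fun t => MeasureTheory.lintegral
      (MeasureTheory.volume.restrict {x : ℝ | ρ + |t| < |x - xc|}) (fun x => ENNReal.ofReal (e ψ t x))
    (∀ z, IsSol ψ z) →
      (∀ t₁ t₂ : ℝ, |t₁| ≤ |t₂| → 0 ≤ t₁ * t₂ → Eext t₂ ≤ Eext t₁)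
      ∧ Filter.liminf Eext Filter.atTop = ⨅ t ∈ Ici (0 : ℝ), Eext t
      ∧ Filter.liminf Eext Filter.atBot = ⨅ t ∈ Iic (0 : ℝ), Eext t
      ∧ (∀ Tp Tm : ℝ, 0 ≤ Tp → Tm ≤ 0 →
          Filter.liminf Eext Filter.atTop + Filter.liminf Eext Filter.atBot ≤ Eext Tp + Eext Tm)
      ∧ Filter.liminf Eext Filter.atTop + Filter.liminf Eext Filter.atBot ≤ 2 * Eext 0 := by
  intro V e IsSol Eext hsol
  have hE : ∀ ⦃t₁ t₂ : ℝ⦄, |t₁| ≤ |t₂| → 0 ≤ t₁ * t₂ → Eext t₂ ≤ Eext t₁ :=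
    fun t₁ t₂ h1 h2 => reggeWheeler_exteriorEnergy_mono_abs hM hr hr' hsℓ xc hρ hψ hsol h1 h2
  exact ⟨fun t₁ t₂ h1 h2 => hE h1 h2, channel_liminf_atTop_eq hE, channel_liminf_atBot_eq hE,
    fun Tp Tm hTp hTm => channel_sum_liminf_le hE hTp hTm, channel_sum_liminf_le_two_mul hE⟩

end WaveEnergy

end

end Summit.FinalStateConjecture.FinalStateConjecture.Theorems
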